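import Literature.NumberTheory.Rogawski1990.TamagawaSingularMembersFinTFCovol            -- ★ p844690 (R2′): `TamagawaSingularMembersFinTFCovol` — the (T′) tower text this lemma PRODUCES (+ ★ p844223's frame, (Q-fin)'s guard)
import Literature.NumberTheory.Automorphic.UnitaryGroupOfLocalCentralizerMeasureKit       -- ★ (O10-s) `UnitaryGroup.exists_tower_ofLocal_eq_quotientMeasure_of_atPoint_eq`
import Literature.NumberTheory.Automorphic.OrbitalMeasureQuotientOfPointSingular           -- ★ `corresponds_local_conj_right` (the guard is conjugation-stable); brings ★ `…atPoint_eq_quotientMeasure_of_forall_map_conj_eq`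
import Literature.NumberTheory.Automorphic.OrbitalMeasureQuotientOfPointHaarChange         -- ★ `OrbitalMeasureFamily.atPoint_eq_quotientMeasure_smul_of_isHaarMeasure`, `isInvInvariant_nnreal_smul`
import Literature.NumberTheory.Automorphic.UnitaryGroupDiagTraceExplicitWeights            -- ★ `isHaarMeasure_eq_of_quotientMeasure_eq` (uniqueness of the centraliser partner)
import Literature.NumberTheory.Weil1964.UnitaryArchSingularTopFormFamilyQuotient           -- ★ (B2c) `exists_atPoint_archSingularTopFormFamily_eq` (the top-form family reads `dν ∕ d(centralizerTopFormHaar)`)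
import Literature.NumberTheory.Weil1964.UnitaryArchSingularCentralizerRationalFrames       -- ★ `exists_isSingularArchFrame_cmRationalToArch` (frames at `γ₀ ⊗ 1`)
import Literature.NumberTheory.Rogawski1990.AnisotropicUnitarySemisimple                  -- ★ `isSemisimpleElt_of_anisotropic`
import Literature.NumberTheory.Rogawski1990.AdelicStableConjugacy                         -- ★ `archPart_cmDatum_toAdelic` (`(γ)_∞ = γ ⊗ 1`)
import Literature.NumberTheory.Rogawski1990.RegularEltLocalisation                        -- ★ `OrbitalMeasureFamily.IsAdmissibleOn.at_mk_of_isConj`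
import Literature.MeasureTheory.Group.InvariantQuotientCompactOpenMass                    -- ★ `quotientMeasure_image_mk_mul_eq` (Weil's mass formula on an open subgroup)
import HarnessLib

/-!
# ROAD F′ (W9), FILE J1 — the Tamagawa-type CENTRALISER TOWER at a singular non-central rational class, built from the (Q-fin)+(COH-fin) Weil partners of
# ★ `TamagawaSingularMembersFinTFCovol`, with its archimedean factor EXACTLY the top-form measure (Rogawski 1990 §1.7 p. 6, §4.3 p. 43, §5.4 p. 72, §14.5 pp. 238–239)

Topic `NumberTheory/Rogawski1990`; namespace `Literature.NumberTheory.Rogawski1990`.  THEOREMS ONLY (no `def`, no instance, no notation, no named fact, no `sorry`).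
Cell `pub/hodgecm-mathlib`, crux H413 = stmt-HodgeConjecture-24833; ROAD F′ «S1finTF ⟸ COVOL» (LEAD F0P3a-plan (g10) T9-40 (d3); owner F0P3a-p07 (g10) SPEC (W9)
`F0/P3a/F0P3a-p07/g10/SPEC-W9-finTF-of-finTFCovol.F0P3ap07g10.md` 4a4af3d0d52254ea, steps 1–3 «per-class lemma»); F0P3-p02 (g13).  Count-neutral.  HONEST LABEL: HC_CM is
proved only modulo the printed citations until rung 0 closes.

WHAT.  The junction (W9) `TamagawaSingularMembersFinTFCovol ⟹ TamagawaSingularMembersFinTF` must, for a (K7-s) partner family `νZ` (`ofLocal mGs TF c = dνA ∕ dνZ(c)`),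
EXHIBIT the (T′) tower of ★ p844690 at every singular non-central class and compare.  This file does the per-class half: given the frame's level-normalised local
Haar data (`hK : νG_v(U(H′)(𝒪_v)) = 1`), finite members `mGs` that are Weil quotients of `νG_v` by CONJUGATION-COHERENT partners `tGs v` on (Q-fin)'s guard
((Q-fin) + (COH-fin) of ★ p844690), a singular non-central rational class `c` and an exceptional set `S₀` off which `mGs` is normalised at `γ_c`, and an adelic
Haar measure `νA`: there are an archimedean Haar measure `νi`, the finite-adelic level Haar measure `νf` (the restricted product of the model local Haar measures
over `S₀`) with `νA = e_* (νi ⊗ νf)`, and a Haar, right- and inversion-invariant measure `T` on `Z_c(𝔸) = U(H′)(𝔸)_{γ_c}` such that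
(i) **`ofLocal mGs TF c = dνA ∕ d(κ • T)`** with `κ = haarScalarFactor νi νGi` and `TF = archSingularTopFormFamily L H′ νGi`, and
(ii) **`T` satisfies the (T′) tower equations of ★ `TamagawaSingularMembersFinTFCovol` VERBATIM** (model partners of mass one on the level boxes off `S₀`; `ρ`, `ρM`,
`tf`; `map prodEquiv tP = centralizerTopFormHaar L H′ (γ_c)_∞ ⊗ tf`; `T = (e|)_* tP`).  PROOF = ★ (O10-s) `UnitaryGroup.exists_tower_ofLocal_eq_quotientMeasure_of_atPoint_eq`
with its five inputs DISCHARGED: `hat` («`(mGs v).atPoint (γ_c)_v = dνG_v ∕ d(tGs v (γ_c)_v)`», ★ `OrbitalMeasureFamily.IsQuotientOf.atPoint_eq_quotientMeasure_of_forall_map_conj_eq`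
fed with (COH-fin) and the conjugation-stability of the guard ★ `corresponds_local_conj_right`), `hadm` (★ `IsQuotientOf.isAdmissibleOn`), `ht1K` («`tGs v (γ_c)_v (Z ∩ U(H′)(𝒪_v)) = 1`
off `S₀`», Weil's mass formula ★ `quotientMeasure_image_mk_mul_eq` read on `IsNormalisedOff` and `hK`), `harch` (★ B2c `exists_atPoint_archSingularTopFormFamily_eq` at the rational
frame ★ `exists_isSingularArchFrame_cmRationalToArch`, rescaled to any archimedean Haar measure by ★ `OrbitalMeasureFamily.atPoint_eq_quotientMeasure_smul_of_isHaarMeasure`);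
then the tower's archimedean factor `ti` is identified as `κ • centralizerTopFormHaar` (uniqueness of the partner, ★ `isHaarMeasure_eq_of_quotientMeasure_eq`) and `κ` is pushed
out of `tP`, `tA` (`Measure.map_smul`, `Measure.prod` homogeneity).  Print: the measures of (K7-s) are «compatible measures … `dg = c|Ω|_v`» [§1.7 p. 6], Tamagawa-type
= level-normalised finite part × top-form archimedean part [§14.5 p. 239; Kottwitz1988 Prop. 2].

* **`exists_covolTower_of_partners`** — the per-class tower (J1).  The junction (J2) `tamagawaSingularMembersFinTF_of_finTFCovol` is the road's next file.

## References
* [Rogawski1990] J. D. Rogawski, *Automorphic Representations of Unitary Groups in Three Variables*, Ann. of Math. Stud. 123 (1990), §1.7 p. 6, p. 11; §4.3 (4.3.1) pp. 43–44;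
  §5.4 p. 72; §14.5 Lemma 14.5.2 (b) pp. 238–239.
* [Kottwitz1988] R. E. Kottwitz, *Tamagawa numbers*, Ann. of Math. 127 (1988), Prop. 2.
* [DeitmarEchterhoff2014] A. Deitmar, S. Echterhoff, *Principles of Harmonic Analysis*, 2nd ed. (2014), Thm. 1.5.3.
* [Gelbart1975] S. Gelbart, *Automorphic forms on adele groups* (1975), p. 155 (10.19), Remark 9.23.
-/

set_option autoImplicit false

noncomputable section

open MeasureTheory Measure NumberField IsDedekindDomain
open Literature.MeasureTheory.Group Literature.MeasureTheory.RestrictedProduct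
open Literature.Topology.RestrictedProduct Literature.Topology.Algebra.RestrictedProduct
open Literature.NumberTheory.Automorphic
open Literature.AlgebraicGeometry.ShimuraVarieties (unitaryGroup hermForm)
open scoped Matrix MatrixGroups RestrictedProduct NNReal ENNReal

namespace Literature.NumberTheory.Rogawski1990

section Tower

variable (L : Type) [Field L] [NumberField L] [IsCMField L] (H' : Matrix (Fin 3) (Fin 3) L)
  [∀ g : (UnitaryGroup.cmDatum L 3 H').Adelic, MeasurableSpace ((UnitaryGroup.cmDatum L 3 H').Adelic ⧸ Subgroup.centralizer ({g} : Set (UnitaryGroup.cmDatum L 3 H').Adelic))]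
  [∀ g : (UnitaryGroup.cmDatum L 3 H').Adelic, BorelSpace ((UnitaryGroup.cmDatum L 3 H').Adelic ⧸ Subgroup.centralizer ({g} : Set (UnitaryGroup.cmDatum L 3 H').Adelic))]
  [∀ a : UnitaryGroup.arch (↥(maximalRealSubfield L)) L (IsCMField.complexConj L) 3 H', MeasurableSpace (UnitaryGroup.arch (↥(maximalRealSubfield L)) L (IsCMField.complexConj L) 3 H' ⧸ Subgroup.centralizer ({a} : Set (UnitaryGroup.arch (↥(maximalRealSubfield L)) L (IsCMField.complexConj L) 3 H')))]
  [∀ a : UnitaryGroup.arch (↥(maximalRealSubfield L)) L (IsCMField.complexConj L) 3 H', BorelSpace (UnitaryGroup.arch (↥(maximalRealSubfield L)) L (IsCMField.complexConj L) 3 H' ⧸ Subgroup.centralizer ({a} : Set (UnitaryGroup.arch (↥(maximalRealSubfield L)) L (IsCMField.complexConj L) 3 H')))]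
  [∀ (v : HeightOneSpectrum (𝓞 ↥(maximalRealSubfield L))) (x : (UnitaryGroup.cmDatum L 3 H').Local v), MeasurableSpace ((UnitaryGroup.cmDatum L 3 H').Local v ⧸ Subgroup.centralizer ({x} : Set ((UnitaryGroup.cmDatum L 3 H').Local v)))]
  [∀ (v : HeightOneSpectrum (𝓞 ↥(maximalRealSubfield L))) (x : (UnitaryGroup.cmDatum L 3 H').Local v), BorelSpace ((UnitaryGroup.cmDatum L 3 H').Local v ⧸ Subgroup.centralizer ({x} : Set ((UnitaryGroup.cmDatum L 3 H').Local v)))]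
  [∀ v : HeightOneSpectrum (𝓞 ↥(maximalRealSubfield L)), MeasurableSpace ((UnitaryGroup.cmDatum L 3 H').Local v)] [∀ v : HeightOneSpectrum (𝓞 ↥(maximalRealSubfield L)), BorelSpace ((UnitaryGroup.cmDatum L 3 H').Local v)]
  [∀ v : HeightOneSpectrum (𝓞 ↥(maximalRealSubfield L)), MeasurableSpace ↥(UnitaryGroup.localPi L (IsCMField.complexConj L) 3 H' v)]
  [∀ v : HeightOneSpectrum (𝓞 ↥(maximalRealSubfield L)), BorelSpace ↥(UnitaryGroup.localPi L (IsCMField.complexConj L) 3 H' v)]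
  [MeasurableSpace ↥(UnitaryGroup.finAdelic (↥(maximalRealSubfield L)) L (IsCMField.complexConj L) 3 H')] [BorelSpace ↥(UnitaryGroup.finAdelic (↥(maximalRealSubfield L)) L (IsCMField.complexConj L) 3 H')]
  [MeasurableSpace (UnitaryGroup.cmDatum L 3 H').Adelic] [BorelSpace (UnitaryGroup.cmDatum L 3 H').Adelic]
  [MeasurableSpace (UnitaryGroup.arch (↥(maximalRealSubfield L)) L (IsCMField.complexConj L) 3 H')] [BorelSpace (UnitaryGroup.arch (↥(maximalRealSubfield L)) L (IsCMField.complexConj L) 3 H')]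

set_option maxHeartbeats 16000000 in
set_option synthInstance.maxHeartbeats 800000 in
-- HB: one instantiation of ★ (O10-s) `exists_tower_ofLocal_eq_quotientMeasure_of_atPoint_eq` on the concrete `cmDatum` ∕ restricted-product carriers (its own budget)
/-- **(W9)∕J1 — THE (T′) TOWER AT A SINGULAR NON-CENTRAL CLASS FROM CONJUGATION-COHERENT WEIL PARTNERS.**  `H′` anisotropic hermitian; `νG_v` Haar, right invariant,
level-normalised (`hK`); `mGs v` the Weil quotient of `νG_v` by `tGs v` on (Q-fin)'s guard (`hQ`), `tGs v` conjugation-coherent there (`hCoh` = (COH-fin)); `νGi` an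
archimedean Haar measure (the top-form family `TF := archSingularTopFormFamily L H′ νGi`); `νA` Haar; the model identifications `ψ = localPiEquiv`, `e = adelicProdEquiv⁻¹`
bound as data with equations; `c` a singular (`hreg`) non-central (`hcen`) rational class and `S₀` an exceptional set off which `mGs` is normalised at `γ_c` (`hS₀`).
THEN `∃ νi νf T`: `νi` Haar right invariant with `νA = e_* (νi ⊗ νf)`, `νf` the finite-adelic level Haar measure over `S₀`, `T` Haar right- and inversion-invariant on
`Z_c(𝔸)` with **`ofLocal mGs TF c = quotientMeasure Z_c(𝔸) (haarScalarFactor νi νGi • T) νA`** and **the (T′) tower equations of ★ `TamagawaSingularMembersFinTFCovol` for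
`T` over `S₀`** (verbatim: level boxes of mass one off `S₀`, `ρ`, `ρM`, `tf`, `map prodEquiv tP = centralizerTopFormHaar L H′ (γ_c)_∞ ⊗ tf`, `T = (e|)_* tP`).
[cite: Rogawski1990, §1.7 p. 6; §4.3 (4.3.1) pp. 43–44; §5.4 p. 72; §14.5 Lemma 14.5.2 (b) p. 239] [cite: Kottwitz1988, Prop. 2] [cite: DeitmarEchterhoff2014, Thm. 1.5.3]
[cite: Gelbart1975, p. 155 (10.19)] -/
theorem exists_covolTower_of_partners
    (hanis : ∀ x : Fin 3 → L, hermForm (cmConjRingHom L) H' x x = 0 → x = 0) (hherm : (H'.map (cmConjRingHom L))ᵀ = H')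
    (νG : ∀ v : HeightOneSpectrum (𝓞 ↥(maximalRealSubfield L)), Measure ((UnitaryGroup.cmDatum L 3 H').Local v)) [∀ v, (νG v).IsHaarMeasure] [∀ v, (νG v).IsMulRightInvariant]
    (hK : ∀ v : HeightOneSpectrum (𝓞 ↥(maximalRealSubfield L)), νG v (UnitaryGroup.cmLocalIntegralLevel L 3 H' v : Set ((UnitaryGroup.cmDatum L 3 H').Local v)) = 1)
    (mGs : ∀ v : HeightOneSpectrum (𝓞 ↥(maximalRealSubfield L)), OrbitalMeasureFamily ((UnitaryGroup.cmDatum L 3 H').Local v))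
    (tGs : ∀ (v : HeightOneSpectrum (𝓞 ↥(maximalRealSubfield L))) (γ : (UnitaryGroup.cmDatum L 3 H').Local v), Measure ↥(Subgroup.centralizer ({γ} : Set ((UnitaryGroup.cmDatum L 3 H').Local v))))
    (hQ : ∀ v, (mGs v).IsQuotientOf (fun x : (UnitaryGroup.cmDatum L 3 H').Local v => ∃ γ₀ : (UnitaryGroup.cmDatum L 3 H').Rational, ¬ IsRegularElt (γ₀.val : GL (Fin 3) L) ∧
            Corresponds (UnitaryGroup.conjLocal L (IsCMField.complexConj L) v)
              ((UnitaryGroup.adelicForm L 3 H').map (UnitaryGroup.adeleToLocal L v))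
              ((UnitaryGroup.adelicForm L 3 H').map (UnitaryGroup.adeleToLocal L v))
              ((UnitaryGroup.cmDatum L 3 H').toLocal v ((UnitaryGroup.cmDatum L 3 H').toAdelic γ₀)) x) (νG v) (tGs v))
    (hCoh : ∀ (v : HeightOneSpectrum (𝓞 ↥(maximalRealSubfield L))) (γ₁ γ₂ q : (UnitaryGroup.cmDatum L 3 H').Local v) (hq : (MulAut.conj q : (UnitaryGroup.cmDatum L 3 H').Local v ≃* (UnitaryGroup.cmDatum L 3 H').Local v) γ₁ = γ₂),
        (∃ γ₀ : (UnitaryGroup.cmDatum L 3 H').Rational, ¬ IsRegularElt (γ₀.val : GL (Fin 3) L) ∧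
            Corresponds (UnitaryGroup.conjLocal L (IsCMField.complexConj L) v)
              ((UnitaryGroup.adelicForm L 3 H').map (UnitaryGroup.adeleToLocal L v))
              ((UnitaryGroup.adelicForm L 3 H').map (UnitaryGroup.adeleToLocal L v))
              ((UnitaryGroup.cmDatum L 3 H').toLocal v ((UnitaryGroup.cmDatum L 3 H').toAdelic γ₀)) γ₁) →
        Measure.map (subgroupCongrHomeomorph (MulAut.conj q : (UnitaryGroup.cmDatum L 3 H').Local v ≃* (UnitaryGroup.cmDatum L 3 H').Local v) (Subgroup.centralizer ({γ₁} : Set ((UnitaryGroup.cmDatum L 3 H').Local v)))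
          (Subgroup.centralizer ({γ₂} : Set ((UnitaryGroup.cmDatum L 3 H').Local v))) (forall_apply_mem_centralizer_singleton_iff_of_eq (MulAut.conj q : (UnitaryGroup.cmDatum L 3 H').Local v ≃* (UnitaryGroup.cmDatum L 3 H').Local v) hq)
          (continuous_mulAutConj q) (continuous_mulAutConj_symm q)) (tGs v γ₁) = tGs v γ₂)
    (νGi : Measure (UnitaryGroup.arch (↥(maximalRealSubfield L)) L (IsCMField.complexConj L) 3 H')) [νGi.IsHaarMeasure] [νGi.IsMulRightInvariant]
    (νA : Measure (UnitaryGroup.cmDatum L 3 H').Adelic) [νA.IsHaarMeasure]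
    (ψ : ∀ v : HeightOneSpectrum (𝓞 ↥(maximalRealSubfield L)), ↥(UnitaryGroup.localPi L (IsCMField.complexConj L) 3 H' v) ≃ₜ* (UnitaryGroup.cmDatum L 3 H').Local v)
    (hψ : ψ = fun v => UnitaryGroup.localPiEquiv L (IsCMField.complexConj L) 3 H' v)
    (e : ↥(UnitaryGroup.arch (↥(maximalRealSubfield L)) L (IsCMField.complexConj L) 3 H') × ↥(UnitaryGroup.finAdelic (↥(maximalRealSubfield L)) L (IsCMField.complexConj L) 3 H') ≃* (UnitaryGroup.cmDatum L 3 H').Adelic)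
    (he' : e = (UnitaryGroup.adelicProdEquiv (↥(maximalRealSubfield L)) L (IsCMField.complexConj L) 3 H').symm.toMulEquiv) (he : Continuous e) (hes : Continuous e.symm)
    (hg : ∀ g : (UnitaryGroup.cmDatum L 3 H').Adelic, e (UnitaryGroup.archPart (↥(maximalRealSubfield L)) L (IsCMField.complexConj L) 3 H' g, UnitaryGroup.finPart (↥(maximalRealSubfield L)) L (IsCMField.complexConj L) 3 H' g) = g)
    (c : ConjClasses (UnitaryGroup.cmDatum L 3 H').Rational) (hreg : ¬ IsRegularElt ((Quotient.out c).val : GL (Fin 3) L))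
    (hcen : ¬ ∃ ζ : L, (((Quotient.out c).val : GL (Fin 3) L) : Matrix (Fin 3) (Fin 3) L) = ζ • (1 : Matrix (Fin 3) (Fin 3) L))
    (S₀ : Finset (HeightOneSpectrum (𝓞 ↥(maximalRealSubfield L)))) (hS₀ : UnitaryGroup.IsNormalisedOff L 3 H' mGs ((UnitaryGroup.cmDatum L 3 H').toAdelic (Quotient.out c)) S₀) :
    ∃ (νi : Measure (UnitaryGroup.arch (↥(maximalRealSubfield L)) L (IsCMField.complexConj L) 3 H')) (νf : Measure (UnitaryGroup.finAdelic (↥(maximalRealSubfield L)) L (IsCMField.complexConj L) 3 H'))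
      (T : Measure (Subgroup.centralizer ({((UnitaryGroup.cmDatum L 3 H').toAdelic (Quotient.out c))} : Set (UnitaryGroup.cmDatum L 3 H').Adelic))),
    ∃ (_ : IsHaarMeasure νi) (_ : νi.IsMulRightInvariant) (_ : IsHaarMeasure νf) (_ : νf.IsMulRightInvariant)
      (_ : IsHaarMeasure T) (_ : T.IsMulRightInvariant) (_ : T.IsInvInvariant) (_ : νA.IsMulRightInvariant)
      (_ : IsHaarMeasure (Measure.haarScalarFactor νi νGi • T)) (_ : (Measure.haarScalarFactor νi νGi • T).IsInvInvariant),
      νA = Measure.map e (νi.prod νf) ∧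
      νf = Measure.map (UnitaryGroup.finAdelicEquiv (↥(maximalRealSubfield L)) L (IsCMField.complexConj L) 3 H').symm.toMulEquiv
        (rpMeasure (fun v => (UnitaryGroup.localInt L (IsCMField.complexConj L) 3 H' v : Set ↥(UnitaryGroup.localPi L (IsCMField.complexConj L) 3 H' v))) (fun v => (Measure.map (ψ v).symm (νG v))) S₀) ∧
      UnitaryGroup.AdelicOrbitalMeasureFamily.ofLocal L 3 H' mGs (Literature.NumberTheory.Weil1964.UnitaryArchTopForm.archSingularTopFormFamily L H' νGi) c =
        quotientMeasure (Subgroup.centralizer ({((UnitaryGroup.cmDatum L 3 H').toAdelic (Quotient.out c))} : Set (UnitaryGroup.cmDatum L 3 H').Adelic)) (Measure.haarScalarFactor νi νGi • T) (isClosed_coe_centralizer_singleton _) νA ∧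
      -- the (T′) tower body of ★ `TamagawaSingularMembersFinTFCovol` for `T` over `S₀`, VERBATIM
      ∃ (ρ : Measure (cutout (fun v => UnitaryGroup.localInt L (IsCMField.complexConj L) 3 H' v) (fun v => (Subgroup.centralizer ({(UnitaryGroup.finAdelicEquiv (↥(maximalRealSubfield L)) L (IsCMField.complexConj L) 3 H') (UnitaryGroup.finPart (↥(maximalRealSubfield L)) L (IsCMField.complexConj L) 3 H' ((UnitaryGroup.cmDatum L 3 H').toAdelic (Quotient.out c))) v} : Set ↥(UnitaryGroup.localPi L (IsCMField.complexConj L) 3 H' v)))))) (ρM : Measure (Subgroup.centralizer ({(UnitaryGroup.finAdelicEquiv (↥(maximalRealSubfield L)) L (IsCMField.complexConj L) 3 H') (UnitaryGroup.finPart (↥(maximalRealSubfield L)) L (IsCMField.complexConj L) 3 H' ((UnitaryGroup.cmDatum L 3 H').toAdelic (Quotient.out c)))} : Set (Πʳ v : HeightOneSpectrum (𝓞 ↥(maximalRealSubfield L)), [↥(UnitaryGroup.localPi L (IsCMField.complexConj L) 3 H' v), UnitaryGroup.localInt L (IsCMField.complexConj L) 3 H' v])))) (tf : Measure (Subgroup.centralizer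 ({(UnitaryGroup.finPart (↥(maximalRealSubfield L)) L (IsCMField.complexConj L) 3 H' ((UnitaryGroup.cmDatum L 3 H').toAdelic (Quotient.out c)))} : Set (UnitaryGroup.finAdelic (↥(maximalRealSubfield L)) L (IsCMField.complexConj L) 3 H'))))
        (tP : Measure ((Subgroup.centralizer ({UnitaryGroup.archPart (↥(maximalRealSubfield L)) L (IsCMField.complexConj L) 3 H' ((UnitaryGroup.cmDatum L 3 H').toAdelic (Quotient.out c))} : Set (UnitaryGroup.arch (↥(maximalRealSubfield L)) L (IsCMField.complexConj L) 3 H'))).prod (Subgroup.centralizer ({(UnitaryGroup.finPart (↥(maximalRealSubfield L)) L (IsCMField.complexConj L) 3 H' ((UnitaryGroup.cmDatum L 3 H').toAdelic (Quotient.out c)))} : Set (UnitaryGroup.finAdelic (↥(maximalRealSubfield L)) L (IsCMField.complexConj L) 3 H'))))),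
        (∀ v, v ∉ S₀ → (Measure.map (subgroupCongrHomeomorph (ψ v).symm.toMulEquiv (Subgroup.centralizer ({((UnitaryGroup.cmDatum L 3 H').toLocal v ((UnitaryGroup.cmDatum L 3 H').toAdelic (Quotient.out c)))} : Set ((UnitaryGroup.cmDatum L 3 H').Local v))) (Subgroup.centralizer ({(UnitaryGroup.finAdelicEquiv (↥(maximalRealSubfield L)) L (IsCMField.complexConj L) 3 H') (UnitaryGroup.finPart (↥(maximalRealSubfield L)) L (IsCMField.complexConj L) 3 H' ((UnitaryGroup.cmDatum L 3 H').toAdelic (Quotient.out c))) v} : Set ↥(UnitaryGroup.localPi L (IsCMField.complexConj L) 3 H' v))) (UnitaryGroup.localPiEquiv_symm_mem_centralizer_iff L 3 H' v ((UnitaryGroup.cmDatum L 3 H').toAdelic (Quotient.out c)) (ψ v) (congrFun hψ v)) (ψ v).symm.continuous (ψ v).continuous) (tGs v ((UnitaryGroup.cmDatum L 3 H').toLocal v ((UnitaryGroup.cmDatum L 3 H').toAdelic (Quotient.out c))))) ((((inH (fun v => UnitaryGroup.localInt L (IsCMField.complexConj L) 3 H' v) (fun v => (Subgroup.centralizer ({(UnitaryGroup.finAdelicEquiv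 (↥(maximalRealSubfield L)) L (IsCMField.complexConj L) 3 H') (UnitaryGroup.finPart (↥(maximalRealSubfield L)) L (IsCMField.complexConj L) 3 H' ((UnitaryGroup.cmDatum L 3 H').toAdelic (Quotient.out c))) v} : Set ↥(UnitaryGroup.localPi L (IsCMField.complexConj L) 3 H' v)))) v) : Subgroup (Subgroup.centralizer ({(UnitaryGroup.finAdelicEquiv (↥(maximalRealSubfield L)) L (IsCMField.complexConj L) 3 H') (UnitaryGroup.finPart (↥(maximalRealSubfield L)) L (IsCMField.complexConj L) 3 H' ((UnitaryGroup.cmDatum L 3 H').toAdelic (Quotient.out c))) v} : Set ↥(UnitaryGroup.localPi L (IsCMField.complexConj L) 3 H' v)))) : Set (Subgroup.centralizer ({(UnitaryGroup.finAdelicEquiv (↥(maximalRealSubfield L)) L (IsCMField.complexConj L) 3 H') (UnitaryGroup.finPart (↥(maximalRealSubfield L)) L (IsCMField.complexConj L) 3 H' ((UnitaryGroup.cmDatum L 3 H').toAdelic (Quotient.out c))) v} : Set ↥(UnitaryGroup.localPi L (IsCMField.complexConj L) 3 H' v))))) = 1) ∧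
        ρ = Measure.map (cutoutEquiv (fun v => UnitaryGroup.localInt L (IsCMField.complexConj L) 3 H' v) (fun v => (Subgroup.centralizer ({(UnitaryGroup.finAdelicEquiv (↥(maximalRealSubfield L)) L (IsCMField.complexConj L) 3 H') (UnitaryGroup.finPart (↥(maximalRealSubfield L)) L (IsCMField.complexConj L) 3 H' ((UnitaryGroup.cmDatum L 3 H').toAdelic (Quotient.out c))) v} : Set ↥(UnitaryGroup.localPi L (IsCMField.complexConj L) 3 H' v)))))
        (rpMeasure (fun v => (((inH (fun v => UnitaryGroup.localInt L (IsCMField.complexConj L) 3 H' v) (fun v => (Subgroup.centralizer ({(UnitaryGroup.finAdelicEquiv (↥(maximalRealSubfield L)) L (IsCMField.complexConj L) 3 H') (UnitaryGroup.finPart (↥(maximalRealSubfield L)) L (IsCMField.complexConj L) 3 H' ((UnitaryGroup.cmDatum L 3 H').toAdelic (Quotient.out c))) v} : Set ↥(UnitaryGroup.localPi L (IsCMField.complexConj L) 3 H' v)))) v) : Subgroup (Subgroup.centralizer ({(UnitaryGroup.finAdelicEquiv (↥(maximalRealSubfield L)) L (IsCMField.complexConj L) 3 H') (UnitaryGroup.finPart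 (↥(maximalRealSubfield L)) L (IsCMField.complexConj L) 3 H' ((UnitaryGroup.cmDatum L 3 H').toAdelic (Quotient.out c))) v} : Set ↥(UnitaryGroup.localPi L (IsCMField.complexConj L) 3 H' v)))) : Set (Subgroup.centralizer ({(UnitaryGroup.finAdelicEquiv (↥(maximalRealSubfield L)) L (IsCMField.complexConj L) 3 H') (UnitaryGroup.finPart (↥(maximalRealSubfield L)) L (IsCMField.complexConj L) 3 H' ((UnitaryGroup.cmDatum L 3 H').toAdelic (Quotient.out c))) v} : Set ↥(UnitaryGroup.localPi L (IsCMField.complexConj L) 3 H' v))))) (fun v => (Measure.map (subgroupCongrHomeomorph (ψ v).symm.toMulEquiv (Subgroup.centralizer ({((UnitaryGroup.cmDatum L 3 H').toLocal v ((UnitaryGroup.cmDatum L 3 H').toAdelic (Quotient.out c)))} : Set ((UnitaryGroup.cmDatum L 3 H').Local v))) (Subgroup.centralizer ({(UnitaryGroup.finAdelicEquiv (↥(maximalRealSubfield L)) L (IsCMField.complexConj L) 3 H') (UnitaryGroup.finPart (↥(maximalRealSubfield L)) L (IsCMField.complexConj L) 3 H' ((UnitaryGroup.cmDatum L 3 H').toAdelic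 (Quotient.out c))) v} : Set ↥(UnitaryGroup.localPi L (IsCMField.complexConj L) 3 H' v))) (UnitaryGroup.localPiEquiv_symm_mem_centralizer_iff L 3 H' v ((UnitaryGroup.cmDatum L 3 H').toAdelic (Quotient.out c)) (ψ v) (congrFun hψ v)) (ψ v).symm.continuous (ψ v).continuous) (tGs v ((UnitaryGroup.cmDatum L 3 H').toLocal v ((UnitaryGroup.cmDatum L 3 H').toAdelic (Quotient.out c)))))) S₀) ∧
        ρM = Measure.map (subgroupCongrHomeomorph (MulEquiv.refl (Πʳ v : HeightOneSpectrum (𝓞 ↥(maximalRealSubfield L)), [↥(UnitaryGroup.localPi L (IsCMField.complexConj L) 3 H' v), UnitaryGroup.localInt L (IsCMField.complexConj L) 3 H' v])) (cutout (fun v => UnitaryGroup.localInt L (IsCMField.complexConj L) 3 H' v) (fun v => (Subgroup.centralizer ({(UnitaryGroup.finAdelicEquiv (↥(maximalRealSubfield L)) L (IsCMField.complexConj L) 3 H') (UnitaryGroup.finPart (↥(maximalRealSubfield L)) L (IsCMField.complexConj L) 3 H' ((UnitaryGroup.cmDatum L 3 H').toAdelic (Quotient.out c))) v} : Set ↥(UnitaryGroup.localPi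 L (IsCMField.complexConj L) 3 H' v))))) (Subgroup.centralizer ({(UnitaryGroup.finAdelicEquiv (↥(maximalRealSubfield L)) L (IsCMField.complexConj L) 3 H') (UnitaryGroup.finPart (↥(maximalRealSubfield L)) L (IsCMField.complexConj L) 3 H' ((UnitaryGroup.cmDatum L 3 H').toAdelic (Quotient.out c)))} : Set (Πʳ v : HeightOneSpectrum (𝓞 ↥(maximalRealSubfield L)), [↥(UnitaryGroup.localPi L (IsCMField.complexConj L) 3 H' v), UnitaryGroup.localInt L (IsCMField.complexConj L) 3 H' v]))) (forall_refl_mem_iff (fun v => UnitaryGroup.localInt L (IsCMField.complexConj L) 3 H' v) (fun v => (Subgroup.centralizer ({(UnitaryGroup.finAdelicEquiv (↥(maximalRealSubfield L)) L (IsCMField.complexConj L) 3 H') (UnitaryGroup.finPart (↥(maximalRealSubfield L)) L (IsCMField.complexConj L) 3 H' ((UnitaryGroup.cmDatum L 3 H').toAdelic (Quotient.out c))) v} : Set ↥(UnitaryGroup.localPi L (IsCMField.complexConj L) 3 H' v)))) _ (mem_centralizer_singleton_iff_forall_mem (fun v => UnitaryGroup.localInt L (IsCMField.complexConj L) 3 H'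 v) ((UnitaryGroup.finAdelicEquiv (↥(maximalRealSubfield L)) L (IsCMField.complexConj L) 3 H') (UnitaryGroup.finPart (↥(maximalRealSubfield L)) L (IsCMField.complexConj L) 3 H' ((UnitaryGroup.cmDatum L 3 H').toAdelic (Quotient.out c)))))) continuous_id continuous_id) ρ ∧
        tf = Measure.map (subgroupCongrHomeomorph (UnitaryGroup.finAdelicEquiv (↥(maximalRealSubfield L)) L (IsCMField.complexConj L) 3 H').symm.toMulEquiv (Subgroup.centralizer ({(UnitaryGroup.finAdelicEquiv (↥(maximalRealSubfield L)) L (IsCMField.complexConj L) 3 H') (UnitaryGroup.finPart (↥(maximalRealSubfield L)) L (IsCMField.complexConj L) 3 H' ((UnitaryGroup.cmDatum L 3 H').toAdelic (Quotient.out c)))} : Set (Πʳ v : HeightOneSpectrum (𝓞 ↥(maximalRealSubfield L)), [↥(UnitaryGroup.localPi L (IsCMField.complexConj L) 3 H' v), UnitaryGroup.localInt L (IsCMField.complexConj L) 3 H' v]))) (Subgroup.centralizer ({(UnitaryGroup.finPart (↥(maximalRealSubfield L)) L (IsCMField.complexConj L) 3 H' ((UnitaryGroup.cmDatum L 3 H').toAdelic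 (Quotient.out c)))} : Set (UnitaryGroup.finAdelic (↥(maximalRealSubfield L)) L (IsCMField.complexConj L) 3 H'))) (forall_apply_mem_centralizer_singleton_iff_of_eq (UnitaryGroup.finAdelicEquiv (↥(maximalRealSubfield L)) L (IsCMField.complexConj L) 3 H').symm.toMulEquiv ((UnitaryGroup.finAdelicEquiv (↥(maximalRealSubfield L)) L (IsCMField.complexConj L) 3 H').symm_apply_apply (UnitaryGroup.finPart (↥(maximalRealSubfield L)) L (IsCMField.complexConj L) 3 H' ((UnitaryGroup.cmDatum L 3 H').toAdelic (Quotient.out c))))) (UnitaryGroup.finAdelicEquiv (↥(maximalRealSubfield L)) L (IsCMField.complexConj L) 3 H').symm.continuous (UnitaryGroup.finAdelicEquiv (↥(maximalRealSubfield L)) L (IsCMField.complexConj L) 3 H').continuous) ρM ∧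
        Measure.map (Subgroup.prodEquiv (Subgroup.centralizer ({UnitaryGroup.archPart (↥(maximalRealSubfield L)) L (IsCMField.complexConj L) 3 H' ((UnitaryGroup.cmDatum L 3 H').toAdelic (Quotient.out c))} : Set (UnitaryGroup.arch (↥(maximalRealSubfield L)) L (IsCMField.complexConj L) 3 H'))) (Subgroup.centralizer ({(UnitaryGroup.finPart (↥(maximalRealSubfield L)) L (IsCMField.complexConj L) 3 H' ((UnitaryGroup.cmDatum L 3 H').toAdelic (Quotient.out c)))} : Set (UnitaryGroup.finAdelic (↥(maximalRealSubfield L)) L (IsCMField.complexConj L) 3 H')))) tP = (Literature.NumberTheory.Weil1964.UnitaryArchTopForm.centralizerTopFormHaar L H' (UnitaryGroup.archPart (↥(maximalRealSubfield L)) L (IsCMField.complexConj L) 3 H' ((UnitaryGroup.cmDatum L 3 H').toAdelic (Quotient.out c)))).prod tf ∧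
        T = Measure.map (subgroupCongrHomeomorph e ((Subgroup.centralizer ({UnitaryGroup.archPart (↥(maximalRealSubfield L)) L (IsCMField.complexConj L) 3 H' ((UnitaryGroup.cmDatum L 3 H').toAdelic (Quotient.out c))} : Set (UnitaryGroup.arch (↥(maximalRealSubfield L)) L (IsCMField.complexConj L) 3 H'))).prod (Subgroup.centralizer ({(UnitaryGroup.finPart (↥(maximalRealSubfield L)) L (IsCMField.complexConj L) 3 H' ((UnitaryGroup.cmDatum L 3 H').toAdelic (Quotient.out c)))} : Set (UnitaryGroup.finAdelic (↥(maximalRealSubfield L)) L (IsCMField.complexConj L) 3 H')))) (Subgroup.centralizer ({((UnitaryGroup.cmDatum L 3 H').toAdelic (Quotient.out c))} : Set (UnitaryGroup.cmDatum L 3 H').Adelic)) (forall_apply_mem_centralizer_iff e (hg ((UnitaryGroup.cmDatum L 3 H').toAdelic (Quotient.out c)))) he hes) tP := by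
  classical
  have hdet : H'.det ≠ 0 := Godement.det_ne_zero_of_anisotropic L H' hanis
  -- §0 ambient instances on the centralisers read below
  haveI hLCa : LocallyCompactSpace ↥(Subgroup.centralizer ({UnitaryGroup.archPart (↥(maximalRealSubfield L)) L (IsCMField.complexConj L) 3 H' ((UnitaryGroup.cmDatum L 3 H').toAdelic (Quotient.out c))} : Set (UnitaryGroup.arch (↥(maximalRealSubfield L)) L (IsCMField.complexConj L) 3 H'))) := (isClosed_coe_centralizer_singleton _).isClosedEmbedding_subtypeVal.locallyCompactSpace
  haveI hSCa : SecondCountableTopology ↥(Subgroup.centralizer ({UnitaryGroup.archPart (↥(maximalRealSubfield L)) L (IsCMField.complexConj L) 3 H' ((UnitaryGroup.cmDatum L 3 H').toAdelic (Quotient.out c))} : Set (UnitaryGroup.arch (↥(maximalRealSubfield L)) L (IsCMField.complexConj L) 3 H'))) := TopologicalSpace.Subtype.secondCountableTopology _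
  haveI hLCv : ∀ v : HeightOneSpectrum (𝓞 ↥(maximalRealSubfield L)), LocallyCompactSpace ↥(Subgroup.centralizer ({((UnitaryGroup.cmDatum L 3 H').toLocal v ((UnitaryGroup.cmDatum L 3 H').toAdelic (Quotient.out c)))} : Set ((UnitaryGroup.cmDatum L 3 H').Local v))) :=
    fun v => (isClosed_coe_centralizer_singleton _).isClosedEmbedding_subtypeVal.locallyCompactSpace
  haveI hLCA : LocallyCompactSpace ↥(Subgroup.centralizer ({((UnitaryGroup.cmDatum L 3 H').toAdelic (Quotient.out c))} : Set (UnitaryGroup.cmDatum L 3 H').Adelic)) := (isClosed_coe_centralizer_singleton _).isClosedEmbedding_subtypeVal.locallyCompactSpace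
  -- §1 (Q-fin)'s guard is conjugation-stable and holds at the rational point `(γ_c)_v`
  have hP : ∀ (v : HeightOneSpectrum (𝓞 ↥(maximalRealSubfield L))) (x q : (UnitaryGroup.cmDatum L 3 H').Local v),
      (∃ γ₀ : (UnitaryGroup.cmDatum L 3 H').Rational, ¬ IsRegularElt (γ₀.val : GL (Fin 3) L) ∧
        Corresponds (UnitaryGroup.conjLocal L (IsCMField.complexConj L) v) ((UnitaryGroup.adelicForm L 3 H').map (UnitaryGroup.adeleToLocal L v))
          ((UnitaryGroup.adelicForm L 3 H').map (UnitaryGroup.adeleToLocal L v)) ((UnitaryGroup.cmDatum L 3 H').toLocal v ((UnitaryGroup.cmDatum L 3 H').toAdelic γ₀)) x) →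
      (∃ γ₀ : (UnitaryGroup.cmDatum L 3 H').Rational, ¬ IsRegularElt (γ₀.val : GL (Fin 3) L) ∧
        Corresponds (UnitaryGroup.conjLocal L (IsCMField.complexConj L) v) ((UnitaryGroup.adelicForm L 3 H').map (UnitaryGroup.adeleToLocal L v))
          ((UnitaryGroup.adelicForm L 3 H').map (UnitaryGroup.adeleToLocal L v)) ((UnitaryGroup.cmDatum L 3 H').toLocal v ((UnitaryGroup.cmDatum L 3 H').toAdelic γ₀)) (q * x * q⁻¹)) := by
    rintro v x q ⟨γ₀, hγ₀, hc⟩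
    exact ⟨γ₀, hγ₀, UnitaryGroup.corresponds_local_conj_right L v hc q⟩
  have hγv : ∀ v : HeightOneSpectrum (𝓞 ↥(maximalRealSubfield L)), ∃ γ₀ : (UnitaryGroup.cmDatum L 3 H').Rational, ¬ IsRegularElt (γ₀.val : GL (Fin 3) L) ∧
      Corresponds (UnitaryGroup.conjLocal L (IsCMField.complexConj L) v) ((UnitaryGroup.adelicForm L 3 H').map (UnitaryGroup.adeleToLocal L v))
        ((UnitaryGroup.adelicForm L 3 H').map (UnitaryGroup.adeleToLocal L v)) ((UnitaryGroup.cmDatum L 3 H').toLocal v ((UnitaryGroup.cmDatum L 3 H').toAdelic γ₀)) ((UnitaryGroup.cmDatum L 3 H').toLocal v ((UnitaryGroup.cmDatum L 3 H').toAdelic (Quotient.out c))) :=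
    fun v => ⟨Quotient.out c, hreg, IsConj.refl _⟩
  -- §2 `hat` ON THE NOSE from (Q-fin) + (COH-fin) (★ `atPoint_eq_quotientMeasure_of_forall_map_conj_eq`), with the partners' Haar flags
  have hat3 : ∀ v : HeightOneSpectrum (𝓞 ↥(maximalRealSubfield L)), ∃ (_ : (tGs v ((UnitaryGroup.cmDatum L 3 H').toLocal v ((UnitaryGroup.cmDatum L 3 H').toAdelic (Quotient.out c)))).IsHaarMeasure) (_ : (tGs v ((UnitaryGroup.cmDatum L 3 H').toLocal v ((UnitaryGroup.cmDatum L 3 H').toAdelic (Quotient.out c)))).IsInvInvariant),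
      (mGs v).atPoint ((UnitaryGroup.cmDatum L 3 H').toLocal v ((UnitaryGroup.cmDatum L 3 H').toAdelic (Quotient.out c))) = quotientMeasure (Subgroup.centralizer ({((UnitaryGroup.cmDatum L 3 H').toLocal v ((UnitaryGroup.cmDatum L 3 H').toAdelic (Quotient.out c)))} : Set ((UnitaryGroup.cmDatum L 3 H').Local v))) (tGs v ((UnitaryGroup.cmDatum L 3 H').toLocal v ((UnitaryGroup.cmDatum L 3 H').toAdelic (Quotient.out c)))) (isClosed_coe_centralizer_singleton _) (νG v) :=
    fun v => (hQ v).atPoint_eq_quotientMeasure_of_forall_map_conj_eq (hP v) (hCoh v) _ (hγv v)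
  haveI htH : ∀ v : HeightOneSpectrum (𝓞 ↥(maximalRealSubfield L)), (tGs v ((UnitaryGroup.cmDatum L 3 H').toLocal v ((UnitaryGroup.cmDatum L 3 H').toAdelic (Quotient.out c)))).IsHaarMeasure := fun v => by
    obtain ⟨h1, _, _⟩ := hat3 v; exact h1
  haveI htI : ∀ v : HeightOneSpectrum (𝓞 ↥(maximalRealSubfield L)), (tGs v ((UnitaryGroup.cmDatum L 3 H').toLocal v ((UnitaryGroup.cmDatum L 3 H').toAdelic (Quotient.out c)))).IsInvInvariant := fun v => by
    obtain ⟨_, h2, _⟩ := hat3 v; exact h2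
  have hat : ∀ v : HeightOneSpectrum (𝓞 ↥(maximalRealSubfield L)),
      (mGs v).atPoint ((UnitaryGroup.cmDatum L 3 H').toLocal v ((UnitaryGroup.cmDatum L 3 H').toAdelic (Quotient.out c))) = quotientMeasure (Subgroup.centralizer ({((UnitaryGroup.cmDatum L 3 H').toLocal v ((UnitaryGroup.cmDatum L 3 H').toAdelic (Quotient.out c)))} : Set ((UnitaryGroup.cmDatum L 3 H').Local v))) (tGs v ((UnitaryGroup.cmDatum L 3 H').toLocal v ((UnitaryGroup.cmDatum L 3 H').toAdelic (Quotient.out c)))) (isClosed_coe_centralizer_singleton _) (νG v) := fun v => by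
    obtain ⟨_, _, h3⟩ := hat3 v; exact h3
  -- §3 `hadm`: Weil quotients are admissible (★ `IsQuotientOf.isAdmissibleOn`), the guard is a class function
  have hadm : ∀ v : HeightOneSpectrum (𝓞 ↥(maximalRealSubfield L)), mGs v (ConjClasses.mk ((UnitaryGroup.cmDatum L 3 H').toLocal v ((UnitaryGroup.cmDatum L 3 H').toAdelic (Quotient.out c)))) ≠ 0 ∧
      SMulInvariantMeasure ((UnitaryGroup.cmDatum L 3 H').Local v) _ (mGs v (ConjClasses.mk ((UnitaryGroup.cmDatum L 3 H').toLocal v ((UnitaryGroup.cmDatum L 3 H').toAdelic (Quotient.out c))))) ∧ IsFiniteMeasureOnCompacts (mGs v (ConjClasses.mk ((UnitaryGroup.cmDatum L 3 H').toLocal v ((UnitaryGroup.cmDatum L 3 H').toAdelic (Quotient.out c))))) :=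
    fun v => (hQ v).isAdmissibleOn.at_mk_of_isConj (fun a b hab ha => by
      obtain ⟨q, hq⟩ := isConj_iff.1 hab
      rw [← hq]
      exact hP v a q ha) _ (hγv v)
  -- §4 `ht1K`: the partners give the level boxes mass one off `S₀` (Weil's mass formula ★ `quotientMeasure_image_mk_mul_eq` on `IsNormalisedOff` and `hK`)
  have ht1K : ∀ v : HeightOneSpectrum (𝓞 ↥(maximalRealSubfield L)), v ∉ S₀ →
      tGs v ((UnitaryGroup.cmDatum L 3 H').toLocal v ((UnitaryGroup.cmDatum L 3 H').toAdelic (Quotient.out c))) (Subtype.val ⁻¹' (UnitaryGroup.cmLocalIntegralLevel L 3 H' v : Set ((UnitaryGroup.cmDatum L 3 H').Local v))) = 1 := by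
    intro v hv
    have h1 := quotientMeasure_image_mk_mul_eq (hH := isClosed_coe_centralizer_singleton _) (Subgroup.centralizer ({((UnitaryGroup.cmDatum L 3 H').toLocal v ((UnitaryGroup.cmDatum L 3 H').toAdelic (Quotient.out c)))} : Set ((UnitaryGroup.cmDatum L 3 H').Local v))) (tGs v ((UnitaryGroup.cmDatum L 3 H').toLocal v ((UnitaryGroup.cmDatum L 3 H').toAdelic (Quotient.out c)))) (νG v)
      (UnitaryGroup.cmLocalIntegralLevel L 3 H' v) (UnitaryGroup.isCompact_isOpen_cmLocalIntegralLevel L 3 H' v).2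
    have h2 := hS₀ v hv
    rw [hat v] at h2
    rw [h2, one_mul, hK v] at h1
    exact h1
  -- §5 `harch`: the top-form family reads `dνi ∕ d(κ • centralizerTopFormHaar)` for EVERY archimedean Haar `νi` (★ B2c at the rational frame, ★ Haar rescale)
  have hframe : ∃ (a b : L) (T : GL (Fin 3) (NumberField.mixedEmbedding.mixedSpace L)) (H_a : Matrix (Fin 2) (Fin 2) L) (H_b : Matrix (Fin 1) (Fin 1) L),
      Literature.NumberTheory.Weil1964.UnitaryArchTopForm.IsSingularArchFrame L H' (UnitaryGroup.archPart (↥(maximalRealSubfield L)) L (IsCMField.complexConj L) 3 H' ((UnitaryGroup.cmDatum L 3 H').toAdelic (Quotient.out c))) a b T H_a H_b := by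
    rw [archPart_cmDatum_toAdelic]
    exact Literature.NumberTheory.Weil1964.UnitaryArchTopForm.exists_isSingularArchFrame_cmRationalToArch hherm hdet (Quotient.out c)
      (isSemisimpleElt_of_anisotropic (cmConjRingHom L) H' hanis _) hreg (fun ζ hζ => hcen ⟨ζ, hζ⟩)
  obtain ⟨hcH, hcI, hcq⟩ := Literature.NumberTheory.Weil1964.UnitaryArchTopForm.exists_atPoint_archSingularTopFormFamily_eq L H' νGi (UnitaryGroup.archPart (↥(maximalRealSubfield L)) L (IsCMField.complexConj L) 3 H' ((UnitaryGroup.cmDatum L 3 H').toAdelic (Quotient.out c))) hframe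
  have harch : ∀ (νi : Measure (UnitaryGroup.arch (↥(maximalRealSubfield L)) L (IsCMField.complexConj L) 3 H')) [IsHaarMeasure νi] [νi.IsMulRightInvariant],
      ∃ ti : Measure ↥(Subgroup.centralizer ({UnitaryGroup.archPart (↥(maximalRealSubfield L)) L (IsCMField.complexConj L) 3 H' ((UnitaryGroup.cmDatum L 3 H').toAdelic (Quotient.out c))} : Set (UnitaryGroup.arch (↥(maximalRealSubfield L)) L (IsCMField.complexConj L) 3 H'))), ∃ (_ : IsHaarMeasure ti) (_ : ti.IsInvInvariant),
        (Literature.NumberTheory.Weil1964.UnitaryArchTopForm.archSingularTopFormFamily L H' νGi).atPoint (UnitaryGroup.archPart (↥(maximalRealSubfield L)) L (IsCMField.complexConj L) 3 H' ((UnitaryGroup.cmDatum L 3 H').toAdelic (Quotient.out c))) = quotientMeasure (Subgroup.centralizer ({UnitaryGroup.archPart (↥(maximalRealSubfield L)) L (IsCMField.complexConj L) 3 H' ((UnitaryGroup.cmDatum L 3 H').toAdelic (Quotient.out c))} : Set (UnitaryGroup.arch (↥(maximalRealSubfield L)) L (IsCMField.complexConj L) 3 H'))) ti (isClosed_coe_centralizer_singleton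 _) νi := by
    intro νi _ _
    obtain ⟨h4, h5, h6⟩ := OrbitalMeasureFamily.atPoint_eq_quotientMeasure_smul_of_isHaarMeasure (UnitaryGroup.archPart (↥(maximalRealSubfield L)) L (IsCMField.complexConj L) 3 H' ((UnitaryGroup.cmDatum L 3 H').toAdelic (Quotient.out c))) hcq νi
    exact ⟨_, h4, h5, h6⟩
  -- §6 THE TOWER (★ O10-s)
  obtain ⟨νi, ti, νrp, ρ, ρM, νf, tf, tP, tA, hνiH, hνiR, htiH, htiI, f1, f2, f3, f4, f5, f6, f7, f8, f9, f10, f11, f12, f13, f14, f15, f16, f17, f18, f19, f20, f21,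
      hti, -, ht1, hνrp, hρ, hρM, hνf, htf, htP, htA, hνA, hof⟩ :=
    UnitaryGroup.exists_tower_ofLocal_eq_quotientMeasure_of_atPoint_eq L 3 H' mGs (Literature.NumberTheory.Weil1964.UnitaryArchTopForm.archSingularTopFormFamily L H' νGi) c hanis hherm hdet νG hK (fun v => tGs v ((UnitaryGroup.cmDatum L 3 H').toLocal v ((UnitaryGroup.cmDatum L 3 H').toAdelic (Quotient.out c)))) hat hadm S₀ ht1K νA harch ψ hψ
      (forall_apply_mem_centralizer_singleton_iff_of_eq (UnitaryGroup.finAdelicEquiv (↥(maximalRealSubfield L)) L (IsCMField.complexConj L) 3 H').symm.toMulEquiv ((UnitaryGroup.finAdelicEquiv (↥(maximalRealSubfield L)) L (IsCMField.complexConj L) 3 H').symm_apply_apply (UnitaryGroup.finPart (↥(maximalRealSubfield L)) L (IsCMField.complexConj L) 3 H' ((UnitaryGroup.cmDatum L 3 H').toAdelic (Quotient.out c)))))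
      e he' he hes (hg _)
  -- §7 the tower's archimedean factor IS `κ • centralizerTopFormHaar`, `κ = haarScalarFactor νi νGi` (uniqueness of the partner ★ `isHaarMeasure_eq_of_quotientMeasure_eq`)
  obtain ⟨hκH, hκI, hκq⟩ := OrbitalMeasureFamily.atPoint_eq_quotientMeasure_smul_of_isHaarMeasure (UnitaryGroup.archPart (↥(maximalRealSubfield L)) L (IsCMField.complexConj L) 3 H' ((UnitaryGroup.cmDatum L 3 H').toAdelic (Quotient.out c))) hcq νi
  have hti' : ti = Measure.haarScalarFactor νi νGi • (Literature.NumberTheory.Weil1964.UnitaryArchTopForm.centralizerTopFormHaar L H' (UnitaryGroup.archPart (↥(maximalRealSubfield L)) L (IsCMField.complexConj L) 3 H' ((UnitaryGroup.cmDatum L 3 H').toAdelic (Quotient.out c)))) :=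
    isHaarMeasure_eq_of_quotientMeasure_eq (hH := isClosed_coe_centralizer_singleton _) _ νi ti _ (hti.symm.trans hκq)
  have hκ0 : Measure.haarScalarFactor νi νGi ≠ 0 := (Measure.haarScalarFactor_pos_of_isHaarMeasure νi νGi).ne'
  have hκi0 : (Measure.haarScalarFactor νi νGi)⁻¹ ≠ 0 := inv_ne_zero hκ0
  -- §8 push `κ` out: `T := κ⁻¹ • tA`, `tP′ := κ⁻¹ • tP`
  haveI hTH : IsHaarMeasure ((Measure.haarScalarFactor νi νGi)⁻¹ • tA) := IsHaarMeasure.nnreal_smul tA hκi0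
  haveI hTI : ((Measure.haarScalarFactor νi νGi)⁻¹ • tA).IsInvInvariant := isInvInvariant_nnreal_smul tA _
  have hsm : Measure.haarScalarFactor νi νGi • ((Measure.haarScalarFactor νi νGi)⁻¹ • tA) = tA := by
    rw [smul_smul, mul_inv_cancel₀ hκ0, one_smul]
  haveI hκTH : IsHaarMeasure (Measure.haarScalarFactor νi νGi • ((Measure.haarScalarFactor νi νGi)⁻¹ • tA)) := by rw [hsm]; exact f17
  haveI hκTI : (Measure.haarScalarFactor νi νGi • ((Measure.haarScalarFactor νi νGi)⁻¹ • tA)).IsInvInvariant := by rw [hsm]; exact f19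
  -- `quotientMeasure` only depends on the centraliser measure through its value (instance arguments are propositions)
  have hcongr : ∀ (ρ₁ ρ₂ : Measure ↥(Subgroup.centralizer ({((UnitaryGroup.cmDatum L 3 H').toAdelic (Quotient.out c))} : Set (UnitaryGroup.cmDatum L 3 H').Adelic))) [IsHaarMeasure ρ₁] [ρ₁.IsInvInvariant] [IsHaarMeasure ρ₂] [ρ₂.IsInvInvariant], ρ₁ = ρ₂ →
      quotientMeasure (Subgroup.centralizer ({((UnitaryGroup.cmDatum L 3 H').toAdelic (Quotient.out c))} : Set (UnitaryGroup.cmDatum L 3 H').Adelic)) ρ₁ (isClosed_coe_centralizer_singleton _) νA = quotientMeasure (Subgroup.centralizer ({((UnitaryGroup.cmDatum L 3 H').toAdelic (Quotient.out c))} : Set (UnitaryGroup.cmDatum L 3 H').Adelic)) ρ₂ (isClosed_coe_centralizer_singleton _) νA := by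
    intro ρ₁ ρ₂ _ _ _ _ h12
    subst h12
    rfl
  refine ⟨νi, νf, (Measure.haarScalarFactor νi νGi)⁻¹ • tA, hνiH, hνiR, f9, f10, hTH, inferInstance, hTI, f21, hκTH, hκTI, hνA, ?_, ?_,
    ρ, ρM, tf, (Measure.haarScalarFactor νi νGi)⁻¹ • tP, ht1, hρ, hρM, htf, ?_, ?_⟩
  · rw [hνf, hνrp]
  · rw [hof]
    exact hcongr _ _ hsm.symm
  · rw [Measure.map_smul, htP, hti', Measure.prod_def, Measure.prod_def, Measure.bind_smul, smul_smul, inv_mul_cancel₀ hκ0, one_smul]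
  · rw [Measure.map_smul, ← htA]

end Tower

end Literature.NumberTheory.Rogawski1990

end
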